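import Literature.NumberTheory.Sieve.ParityWave0
import Literature.NumberTheory.Sieve.BatemanHorn
import HarnessLib

/-!
# Primes of the form `x³ + 2y³` (Heath-Brown 2001): the quantitative theorem and the top reduction

Topic `Literature/NumberTheory/Sieve`, sibling of `ParityWave0.lean`, whose named fact
`Literature.NumberTheory.Sieve.setOf_prime_cube_add_two_mul_cube_infinite` (**parity.S18**: infinitely many primes
`x³ + 2y³` with `x, y ≥ 1`) this file serves. Source: D. R. Heath-Brown, *Primes represented by
`x³ + 2y³`*, Acta Math. 186 (2001) 1–84 [HeathBrownActa2001] — the (single, unnumbered)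
Theorem on p. 2 (cited as "Theorem 1" in `ParityWave0`; here `Theorem (p. 2)`), its sequence form
(2.2) (§2, p. 4), and the singular product `σ₀` (p. 2; convergence proved on p. 37, display (6.7)).

Discharging `setOf_prime_cube_add_two_mul_cube_infinite` outright means formalising the whole
84-page argument (a Buchstab sieve over the ideals of `K = ℚ(2^{1/3})` with Type I level `X^{2-ε}`
(Lemmas 2.1, 3.2), Fundamental-Lemma and upper-bound sieve estimates (Lemmas 3.5–3.7), a
Siegel–Walfisz analogue for `ℤ[2^{1/3}]` (Lemma 3.8), and the Type II bound via the large sieve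
over `K` (Lemma 3.10)); none of these inputs is in Mathlib and the prime ideal theorem itself is only
the named fact `Literature.NumberTheory.LFunctions.NumberField.primeIdealTheorem` in the tree. This file is the TOP LAYER of that
decomposition: it vendors the printed quantitative theorem as a named fact and PROVES that it
implies the qualitative statement of `ParityWave0`.

## Content (namespace `Literature.CubicPrimes`)

* `cubeRootTwoCount p = ν_p`, the number of solutions of `x³ ≡ 2 (mod p)` (p. 2; for a prime `p`
  also the number of first-degree prime ideals of `K` above `p`, Lemma 2.1 and the remark after
  Lemma 2.2), kept decidable (values by `decide`) and BRIDGED to the tree's general local root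
  count: `cubeRootTwoCount_eq_polyRootCountMod : ν_p = Literature.polyRootCountMod ![X³ − 2] p`
  (`BatemanHorn.lean`, `ω_f(p)` for `f = X³ − 2`). API: values at `p = 2, 3, 5, 7, 31`, `ν_p ≤ p`,
  `ν_p ≤ 3` for `p` prime.
* `singularProductPartial N = ∏_{p < N} (1 − (ν_p − 1)/p)`, the ordered partial products of
  Heath-Brown's `σ₀ = ∏_p (1 − (ν_p − 1)/p)` (p. 2). API: every partial product is positive.
* `primePairCount X η = π(𝒜)`, the number of pairs `(x, y)` of coprime integers with
  `X < x, y ≤ X(1 + η)` and `x³ + 2y³` prime, i.e. the number of primes, with multiplicity, in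
  Heath-Brown's weighted sequence `𝒜 = {x³ + 2y³ : x, y ∈ (X, X(1+η)] ∩ ℕ, (x, y) = 1}` (§2, p. 4).
  API: the coprimality condition is automatic (`coprime_of_prime_cube_add_two_mul_cube`).
* `mainTerm c σ₀ X = σ₀ η² X² / (3 log X)` with `η = (log X)^{−c}` — the printed main term.
* NAMED FACT `HeathBrown2001_singularProduct`: the product `σ₀` converges (in the classical sense:
  the partial products tend to a limit `σ₀ ≠ 0`, here `σ₀ > 0` since every factor is positive).
  [HeathBrownActa2001, p. 2 and (6.7), p. 37 — from the prime number theorem and the prime ideal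
  theorem for `K` with error terms.]
* NAMED FACT `HeathBrown2001_primePairCount_asymptotic` — **the Theorem of the paper (p. 2) in the
  form (2.2)**: there is `c > 0` such that with `η = (log X)^{−c}`,
  `π(𝒜) = σ₀ η² X² (3 log X)^{−1} {1 + O((log log X)^{−1/6})}` as `X → ∞`.
* PROVED `HeathBrown2001_primePairCount_asymptotic.singularProduct` (projection) and
  PROVED **`Literature.NumberTheory.Sieve.setOf_prime_cube_add_two_mul_cube_infinite_of_heathBrown2001`**:
  the quantitative theorem implies **parity.S18** (`(log log X)^{−1/6} → 0` and the main term is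
  positive for `X > 1`, so `π(𝒜) > 0` for all large `X`; a counted pair gives a prime
  `x³ + 2y³ ≥ x > X` with `x, y ≥ 1`).

## Faithfulness notes

* The Theorem on p. 2 reads "the number of such primes with `X < x, y ≤ X(1+η)`"; what is proved is
  (2.2), `π(𝒜) = σ₀ η²X²/(3 log X) {1 + O((log log X)^{−1/6})}`, where `π(𝒜)` counts the elements
  of `𝒜` that are prime *with the multiplicity of their representations* and `𝒜` carries the
  condition `(x, y) = 1` (p. 4: "integers in `𝒜` are counted according to the multiplicity of
  representations"). `primePairCount` is exactly `π(𝒜)`; for prime values the coprimality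
  condition is redundant (proved below), it is kept to match `𝒜` literally.
* `η` in §2 ranges over `exp{−(log X)^{1/3}} ≤ η ≤ 1` ((2.1)) as a working hypothesis, but the
  theorem is asserted (and on p. 21 obtained) only for the specific choice `η = (log X)^{−c}`
  (`= (log X)^{−2c₀}` there); the fact quantifies `∃ c > 0` exactly as printed on p. 2.
* `σ₀` is *defined* on p. 2 by the conditionally convergent Euler product; the fact records it as
  the limit of the ordered partial products `singularProductPartial` together with `σ₀ > 0`
  (classical convergence of an infinite product of positive factors means a positive limit; the
  positivity is also forced by the Theorem itself, which deduces infinitely many primes from the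
  asymptotic). No closed form for `σ₀` is claimed.
* The `O`-constant is absolute in the source; `=O[atTop]` (one constant for all large real `X`)
  is implied by, never stronger than, the printed statement. `(log log X)^{−1/6}` is
  `Real.log (Real.log X) ^ (−1/6)` (`Real.rpow`; for `X > e` the base is positive).
* Integer points: `x ∈ ℕ` with `X < x ≤ X(1+η)` is written with real inequalities on the cast
  (the enclosing `Finset.Iic ⌊X(1+η)⌋₊` only bounds the search and loses nothing, see
  `mem_primePairs_iff`), so no floor conventions enter the statement.

## Mathlib / tree search

`rg "x \^ 3 \+ 2|cube_add_two|2y³|HeathBrown"` over Mathlib: nothing relevant (Mathlib has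
`Polynomial.nthRoots`, `ZMod`, `Nat.primesBelow`, `Asymptotics.IsBigO`, `Real.rpow`, all used here).
Tree: the local root count `ν_p` is the case `f = X³ − 2` of `Literature.polyRootCountMod f p = ω_f(p)`
(`Literature/NumberTheory/Sieve/BatemanHorn.lean`, used as `polyRootCountMod ![f] p` e.g. for
`X² + 1` in `AletheiaZomleferFukshanskyGarcia2020Applications.lean`); we keep a decidable
specialisation and prove the bridge `cubeRootTwoCount_eq_polyRootCountMod`, so `σ₀` is literally
the `ω_f`-product of the Bateman–Horn file without the `(1 − 1/p)^{−1}` factors.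
`Literature.NumberTheory.LFunctions.NumberField.primeIdealTheorem` (LFunctions/PrimeIdealTheorem.lean) is the input (2.3) of the
next layer down; `Literature.NumberTheory.Sieve.setOf_prime_cube_add_two_mul_cube_infinite` is imported, not restated.
-/

noncomputable section

open Filter Asymptotics Finset Topology

namespace Literature.NumberTheory.Sieve.CubicPrimes

/-! ### `ν_p`, the singular product `σ₀`, and the prime-pair count `π(𝒜)` -/

/-- `ν_p`, the number of solutions of the congruence `x³ ≡ 2 (mod p)` (counted among
`0 ≤ x < p`; for `p = 0` the count is `0`). For a prime `p` this is also the number of first-degree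
prime ideals of `ℚ(2^{1/3})` above `p` (Heath-Brown, Lemma 2.1 and the remark after Lemma 2.2).
[cite: HeathBrownActa2001, Theorem (p. 2)] -/
def cubeRootTwoCount (p : ℕ) : ℕ :=
  #{n ∈ range p | n ^ 3 ≡ 2 [MOD p]}

/-- `cubeRootTwoCount` unfolded. [cite: HeathBrownActa2001, Theorem (p. 2)] -/
theorem cubeRootTwoCount_def (p : ℕ) :
    cubeRootTwoCount p = #{n ∈ range p | n ^ 3 ≡ 2 [MOD p]} := rfl

open Polynomial in
/-- Bridge to the tree's local root count: `ν_p = ω_f(p)` for the single polynomial `f = X³ − 2`,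
i.e. `cubeRootTwoCount p = Literature.polyRootCountMod ![X³ − 2] p` (`BatemanHorn.lean`), for every `p`
(both sides count `n < p` with `p ∣ n³ − 2`). [folklore] -/
theorem cubeRootTwoCount_eq_polyRootCountMod (p : ℕ) :
    cubeRootTwoCount p = polyRootCountMod ![(X ^ 3 - C 2 : ℤ[X])] p := by
  unfold cubeRootTwoCount polyRootCountMod
  congr 1
  ext n
  simp only [mem_filter, mem_range, Fin.prod_univ_one, Matrix.cons_val_fin_one, eval_sub,
    eval_pow, eval_X, eval_C, and_congr_right_iff]
  intro _
  rw [Nat.modEq_iff_dvd, dvd_sub_comm]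
  push_cast
  exact Iff.rfl

/-- `ν_2 = 1` (`x = 0`). [folklore] -/
theorem cubeRootTwoCount_two : cubeRootTwoCount 2 = 1 := by decide

/-- `ν_3 = 1` (`x = 2`). [folklore] -/
theorem cubeRootTwoCount_three : cubeRootTwoCount 3 = 1 := by decide

/-- `ν_5 = 1` (`x = 3`; `p ≡ 2 (mod 3)` gives exactly one cube root). [folklore] -/
theorem cubeRootTwoCount_five : cubeRootTwoCount 5 = 1 := by decide

/-- `ν_7 = 0` (the cubes modulo `7` are `0, ±1`). [folklore] -/
theorem cubeRootTwoCount_seven : cubeRootTwoCount 7 = 0 := by decide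

/-- `ν_31 = 3` (`4³ = 64 ≡ 2`, and `31 ≡ 1 (mod 3)`; the roots are `4, 7, 20`). [folklore] -/
theorem cubeRootTwoCount_thirtyOne : cubeRootTwoCount 31 = 3 := by decide

/-- Trivially `ν_p ≤ p`. [folklore] -/
theorem cubeRootTwoCount_le (p : ℕ) : cubeRootTwoCount p ≤ p :=
  (card_filter_le _ _).trans (card_range p).le

/-- For a prime `p`, `ν_p ≤ 3`: the solutions inject into the roots of `X³ − 2` in the field
`ℤ/pℤ`. [folklore] -/
theorem cubeRootTwoCount_le_three {p : ℕ} (hp : p.Prime) : cubeRootTwoCount p ≤ 3 := by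
  classical
  haveI := Fact.mk hp
  calc cubeRootTwoCount p
      ≤ #(Polynomial.nthRoots 3 (2 : ZMod p)).toFinset := by
        refine card_le_card_of_injOn (fun n : ℕ => (n : ZMod p)) (fun n hn => ?_) ?_
        · simp only [coe_filter, mem_range, Set.mem_setOf_eq] at hn
          rw [mem_coe, Multiset.mem_toFinset, Polynomial.mem_nthRoots (by norm_num)]
          have h := (ZMod.natCast_eq_natCast_iff _ _ _).2 hn.2
          push_cast at h
          exact h
        · intro a ha b hb hab
          simp only [coe_filter, mem_range, Set.mem_setOf_eq] at ha hb
          have hab' : (a : ZMod p) = (b : ZMod p) := hab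
          have h : (a : ZMod p).val = (b : ZMod p).val := by rw [hab']
          rwa [ZMod.val_cast_of_lt ha.1, ZMod.val_cast_of_lt hb.1] at h
    _ ≤ Multiset.card (Polynomial.nthRoots 3 (2 : ZMod p)) := Multiset.toFinset_card_le _
    _ ≤ 3 := Polynomial.card_nthRoots 3 2

/-- The ordered partial products `∏_{p < N, p prime} (1 − (ν_p − 1)/p)` of Heath-Brown's singular
product `σ₀ = ∏_p (1 − (ν_p − 1)/p)` (conditionally, not absolutely, convergent).
[cite: HeathBrownActa2001, Theorem (p. 2)] -/
def singularProductPartial (N : ℕ) : ℝ :=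
  ∏ p ∈ Nat.primesBelow N, (1 - ((cubeRootTwoCount p : ℝ) - 1) / p)

/-- `singularProductPartial` unfolded. [cite: HeathBrownActa2001, Theorem (p. 2)] -/
theorem singularProductPartial_def (N : ℕ) :
    singularProductPartial N = ∏ p ∈ Nat.primesBelow N, (1 - ((cubeRootTwoCount p : ℝ) - 1) / p) :=
  rfl

/-- Every factor `1 − (ν_p − 1)/p` is positive (`ν_p ≤ p`), hence so is every partial product; in
particular a limit `σ₀` of the partial products is `≥ 0`, and "the product converges" in the
classical sense says `σ₀ > 0`. [folklore] -/
theorem singularProductPartial_pos (N : ℕ) : 0 < singularProductPartial N := by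
  refine prod_pos fun p hp => ?_
  have hp' : 0 < (p : ℝ) := by exact_mod_cast (Nat.prime_of_mem_primesBelow hp).pos
  have hle : (cubeRootTwoCount p : ℝ) ≤ p := by exact_mod_cast cubeRootTwoCount_le p
  rw [sub_pos, div_lt_one hp']
  linarith

/-- The finite set of pairs behind `primePairCount`: pairs `(x, y)` of natural numbers with
`X < x ≤ X(1+η)`, `X < y ≤ X(1+η)`, `(x, y) = 1` and `x³ + 2y³` prime (the bounding box
`[0, ⌊X(1+η)⌋₊]²` loses no such pair, `mem_primePairs_iff`). [cite: HeathBrownActa2001, §2 (2.2)] -/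
def primePairs (X η : ℝ) : Finset (ℕ × ℕ) :=
  {xy ∈ Iic ⌊X * (1 + η)⌋₊ ×ˢ Iic ⌊X * (1 + η)⌋₊ |
      X < xy.1 ∧ (xy.1 : ℝ) ≤ X * (1 + η) ∧ X < xy.2 ∧ (xy.2 : ℝ) ≤ X * (1 + η) ∧
      Nat.Coprime xy.1 xy.2 ∧ (xy.1 ^ 3 + 2 * xy.2 ^ 3).Prime}

/-- `π(𝒜) = π(𝒜)(X, η)`: the number of pairs of coprime natural numbers `x, y ∈ (X, X(1+η)]` with
`x³ + 2y³` prime, i.e. the number of primes in Heath-Brown's sequence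
`𝒜 = {x³ + 2y³ : x, y ∈ (X, X(1+η)] ∩ ℕ, (x, y) = 1}` counted with the multiplicity of their
representations. [cite: HeathBrownActa2001, §2 (2.2)] -/
def primePairCount (X η : ℝ) : ℕ :=
  #(primePairs X η)

/-- Membership in `primePairs`: the bounding box is redundant. [cite: HeathBrownActa2001, §2 (2.2)] -/
theorem mem_primePairs_iff {X η : ℝ} {x y : ℕ} :
    (x, y) ∈ primePairs X η ↔
      X < x ∧ (x : ℝ) ≤ X * (1 + η) ∧ X < y ∧ (y : ℝ) ≤ X * (1 + η) ∧
        Nat.Coprime x y ∧ (x ^ 3 + 2 * y ^ 3).Prime := by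
  simp only [primePairs, mem_filter, mem_product, mem_Iic, and_iff_right_iff_imp]
  rintro ⟨-, hx, -, hy, -, -⟩
  exact ⟨Nat.le_floor hx, Nat.le_floor hy⟩

/-- `primePairCount` unfolded. [cite: HeathBrownActa2001, §2 (2.2)] -/
theorem primePairCount_def (X η : ℝ) : primePairCount X η = #(primePairs X η) := rfl

/-- If `x³ + 2y³` is prime then `(x, y) = 1`: a common prime factor `k` would give
`k³ ∣ x³ + 2y³`, so `k = x³ + 2y³` and `k³ ∣ k`. Hence the condition `(x, y) = 1` in `𝒜` is
redundant for the primes of `𝒜`. [folklore] -/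
theorem coprime_of_prime_cube_add_two_mul_cube {x y : ℕ} (h : (x ^ 3 + 2 * y ^ 3).Prime) :
    Nat.Coprime x y := by
  refine Nat.coprime_of_dvd fun k hk hkx hky => ?_
  have h3 : k ^ 3 ∣ x ^ 3 + 2 * y ^ 3 :=
    (pow_dvd_pow_of_dvd hkx 3).add ((pow_dvd_pow_of_dvd hky 3).mul_left 2)
  have hk1 : k ∣ x ^ 3 + 2 * y ^ 3 := (dvd_pow_self k three_ne_zero).trans h3
  have hkp : k = x ^ 3 + 2 * y ^ 3 := ((Nat.dvd_prime h).1 hk1).resolve_left hk.one_lt.ne'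
  rw [hkp] at h3
  exact absurd (Nat.le_of_dvd h.pos h3) (lt_self_pow₀ h.one_lt (by norm_num : 1 < 3)).not_ge

/-- The printed main term `σ₀ η² X² / (3 log X)` with `η = η(X) = (log X)^{−c}`.
[cite: HeathBrownActa2001, Theorem (p. 2)] -/
def mainTerm (c σ₀ X : ℝ) : ℝ :=
  σ₀ * (Real.log X ^ (-c)) ^ 2 * X ^ 2 / (3 * Real.log X)

/-- `mainTerm` unfolded. [cite: HeathBrownActa2001, Theorem (p. 2)] -/
theorem mainTerm_def (c σ₀ X : ℝ) :
    mainTerm c σ₀ X = σ₀ * (Real.log X ^ (-c)) ^ 2 * X ^ 2 / (3 * Real.log X) := rfl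

/-- The main term is positive for `σ₀ > 0` and `X > 1`. [folklore] -/
theorem mainTerm_pos {c σ₀ X : ℝ} (hσ : 0 < σ₀) (hX : 1 < X) : 0 < mainTerm c σ₀ X := by
  have hL : 0 < Real.log X := Real.log_pos hX
  have hX0 : 0 < X := one_pos.trans hX
  unfold mainTerm
  positivity

/-! ### The named facts -/

/-- **Heath-Brown's singular product converges** (Heath-Brown 2001, p. 2: "the product `σ₀` is
conditionally convergent, but not absolutely convergent"; proved on p. 37, display (6.7), from the
prime number theorem and the prime ideal theorem for `ℚ(2^{1/3})` with error terms, via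
`∑_{Y < p ≤ Z} (ν_p − 1)/p ≪ (log Y)^{−2}`). Stated as: the ordered partial products
`∏_{p < N} (1 − (ν_p − 1)/p)` tend to a limit `σ₀ > 0` (classical convergence of a product of
positive factors). [cite: HeathBrownActa2001, p. 2 and (6.7) p. 37] -/
def HeathBrown2001_singularProduct : Prop :=
  ∃ σ₀ : ℝ, 0 < σ₀ ∧ Tendsto singularProductPartial atTop (𝓝 σ₀)

/-- **Heath-Brown's theorem on primes `x³ + 2y³`, quantitative form** (Heath-Brown, Acta Math. 186
(2001), Theorem, p. 2, in the sequence form (2.2) of §2). There is a positive constant `c` such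
that, with `η = η(X) = (log X)^{−c}` and `σ₀ = ∏_p (1 − (ν_p − 1)/p)` (the limit of the ordered
partial products, `σ₀ > 0`), the number `π(𝒜)` of pairs of coprime integers `X < x, y ≤ X(1+η)`
with `x³ + 2y³` prime satisfies
`π(𝒜) = σ₀ η² X² (3 log X)^{−1} {1 + O((log log X)^{−1/6})}` as `X → ∞`.
[cite: HeathBrownActa2001, Theorem (p. 2) and (2.2)] -/
def HeathBrown2001_primePairCount_asymptotic : Prop :=
  ∃ c : ℝ, 0 < c ∧ ∃ σ₀ : ℝ, 0 < σ₀ ∧ Tendsto singularProductPartial atTop (𝓝 σ₀) ∧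
    (fun X : ℝ => (primePairCount X (Real.log X ^ (-c)) : ℝ) - mainTerm c σ₀ X) =O[atTop]
      fun X : ℝ => mainTerm c σ₀ X * Real.log (Real.log X) ^ (-(1 / 6 : ℝ))

/-- The quantitative theorem records, in particular, the convergence of `σ₀`. [cite: HeathBrownActa2001, Theorem (p. 2)] -/
theorem HeathBrown2001_primePairCount_asymptotic.singularProduct
    (h : HeathBrown2001_primePairCount_asymptotic) : HeathBrown2001_singularProduct := by
  obtain ⟨-, -, σ₀, hσ₀, hlim, -⟩ := h
  exact ⟨σ₀, hσ₀, hlim⟩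

/-! ### The top reduction: the quantitative theorem implies **parity.S18** -/

/-- From the asymptotic, `π(𝒜)(X, (log X)^{−c}) > 0` for all sufficiently large `X`: the relative
error `O((log log X)^{−1/6})` tends to `0` and the main term is positive. [cite: HeathBrownActa2001, Theorem (p. 2)] -/
theorem eventually_primePairCount_pos (h : HeathBrown2001_primePairCount_asymptotic) :
    ∃ c : ℝ, 0 < c ∧ ∀ᶠ X : ℝ in atTop, 0 < primePairCount X (Real.log X ^ (-c)) := by
  obtain ⟨c, hc, σ₀, hσ₀, -, hO⟩ := h
  refine ⟨c, hc, ?_⟩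
  obtain ⟨C, hC⟩ := hO.bound
  -- the relative error tends to `0`
  have hg : Tendsto (fun X : ℝ => Real.log (Real.log X) ^ (-(1 / 6 : ℝ))) atTop (𝓝 0) :=
    (tendsto_rpow_neg_atTop (by norm_num : (0 : ℝ) < 1 / 6)).comp
      (Real.tendsto_log_atTop.comp Real.tendsto_log_atTop)
  have h1 : ∀ᶠ X : ℝ in atTop, |C| * |Real.log (Real.log X) ^ (-(1 / 6 : ℝ))| < 1 := by
    have h' := (hg.abs.const_mul |C|)
    rw [abs_zero, mul_zero] at h'
    exact h'.eventually (gt_mem_nhds one_pos)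
  filter_upwards [hC, h1, eventually_gt_atTop (1 : ℝ)] with X hCX h1X hX
  have hM : 0 < mainTerm c σ₀ X := mainTerm_pos hσ₀ hX
  have hlt : |(primePairCount X (Real.log X ^ (-c)) : ℝ) - mainTerm c σ₀ X| < mainTerm c σ₀ X := by
    calc |(primePairCount X (Real.log X ^ (-c)) : ℝ) - mainTerm c σ₀ X|
        ≤ C * ‖mainTerm c σ₀ X * Real.log (Real.log X) ^ (-(1 / 6 : ℝ))‖ := by
          simpa only [Real.norm_eq_abs] using hCX
      _ ≤ |C| * ‖mainTerm c σ₀ X * Real.log (Real.log X) ^ (-(1 / 6 : ℝ))‖ :=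
          mul_le_mul_of_nonneg_right (le_abs_self C) (norm_nonneg _)
      _ = mainTerm c σ₀ X * (|C| * |Real.log (Real.log X) ^ (-(1 / 6 : ℝ))|) := by
          rw [Real.norm_eq_abs, abs_mul, abs_of_pos hM]; ring
      _ < mainTerm c σ₀ X := mul_lt_of_lt_one_right hM h1X
  have h0 : (0 : ℝ) < primePairCount X (Real.log X ^ (-c)) := by
    have := (abs_sub_lt_iff.1 hlt).2
    linarith
  exact_mod_cast h0

/-- **Heath-Brown's quantitative theorem implies parity.S18**: if
`π(𝒜) = σ₀ η² X² (3 log X)^{−1} {1 + O((log log X)^{−1/6})}` with `σ₀ > 0` (the Theorem of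
Heath-Brown 2001, p. 2), then there are infinitely many primes `x³ + 2y³` with `x, y ≥ 1`
(a pair counted at height `X ≥ n` gives a prime `x³ + 2y³ ≥ x > X ≥ n`). This is the top step of
the decomposition of `Literature.NumberTheory.Sieve.setOf_prime_cube_add_two_mul_cube_infinite`; the hypothesis is
the named fact `HeathBrown2001_primePairCount_asymptotic`. [cite: HeathBrownActa2001, Theorem (p. 2)] -/
theorem _root_.Literature.NumberTheory.Sieve.setOf_prime_cube_add_two_mul_cube_infinite_of_heathBrown2001
    (h : HeathBrown2001_primePairCount_asymptotic) :
    Literature.NumberTheory.Sieve.setOf_prime_cube_add_two_mul_cube_infinite := by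
  obtain ⟨c, -, hev⟩ := eventually_primePairCount_pos h
  refine Set.infinite_of_forall_exists_gt fun n => ?_
  obtain ⟨X, hXn, hX⟩ := ((eventually_ge_atTop (n : ℝ)).and hev).exists
  obtain ⟨⟨x, y⟩, hxy⟩ := card_pos.1 hX
  obtain ⟨hx, -, hy, -, -, hp⟩ := mem_primePairs_iff.1 hxy
  have hn0 : (0 : ℝ) ≤ n := Nat.cast_nonneg n
  have hx0 : 0 < x := by exact_mod_cast hn0.trans hXn |>.trans_lt hx
  have hy0 : 0 < y := by exact_mod_cast hn0.trans hXn |>.trans_lt hy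
  refine ⟨x ^ 3 + 2 * y ^ 3, ⟨hp, x, y, hx0, hy0, rfl⟩, ?_⟩
  have hnx : n < x := by exact_mod_cast hXn.trans_lt hx
  calc n < x := hnx
    _ ≤ x ^ 3 := Nat.le_self_pow three_ne_zero x
    _ ≤ x ^ 3 + 2 * y ^ 3 := Nat.le_add_right _ _

end Literature.NumberTheory.Sieve.CubicPrimes

end
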